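/-
Origin: expansion seat `planner-pub-hodgecm-toy-0`, handover #2 2026-08-18T04:13:45Z (`HOME/pub-hodgecm-toy/lean/Toy/CMFacts.lean`, md5 9ecd590d, 181 lines);
landed by the gen-5 packager in gate run 21 as `HodgeCM/Model/Toy/CMFacts.lean` (import ^import Toy\.→import HodgeCM.Model.Toy. ×1).
-/
-- HANDOVER (planner-pub-hodgecm-toy-0, unit pub-hodgecm-toy): WIP module `Toy.CMFacts`; intended final module
-- `HodgeCM.Model.Toy.CMFacts` (kind L5, toy model / consistency witness); rename `import Toy.X` ↦ the final prefix.
/-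
Copyright: pub-hodgecm cell (HodgeCMPerL). Consistency-witness layer (part (e), referee A G4).

# CM facts in the toy universe: eigenlines (M11), the CM-type condition (M12)

`ℂ ⊗ H¹(A_{(K,Φ)}) ≅ ℂ ⊗_ℚ K = ⊕_σ ℂ·eps σ`; the `σ`-eigenline is `ℂ·eps σ`, and it is holomorphic
exactly when `σ ∈ Φ`.
-/
import Mathlib
import Summits.HodgeConjecture.HodgeCM.Model.Toy.Axioms

namespace HodgeCM.Toy

open Literature.AlgebraicGeometry.Motives
open Literature.AlgebraicGeometry.Motives.HodgeStructure (EndAction conj ofRat complexConj complexConj_top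
  piece_of_add_eq)
open scoped TensorProduct
open exteriorPower CMPresentation

noncomputable section

variable (D : HodgeData) (K : CMField) (Φ : CMType K)

/-! ### The comparison `ℂ ⊗ ⋀¹ L(A_{(K,Φ)}) ≃ ℂ ⊗ FK K` -/

/-- `⋀¹ (Unit → FK K) ≃ FK K` -/
def E1 : ↥(⋀[ℚ]^1 (cmObj K Φ).L) ≃ₗ[ℚ] FK K :=
  (oneEquiv ℚ (cmObj K Φ).L).trans (LinearEquiv.funUnique Unit ℚ (FK K))

/-- its complexification -/
def T : ℂ ⊗[ℚ] ↥(⋀[ℚ]^1 (cmObj K Φ).L) ≃ₗ[ℂ] ℂ ⊗[ℚ] FK K := (E1 K Φ).baseChange ℚ ℂ _ _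

/-- (Ported verbatim from the HodgeCMPerL package; no docstring in the source.) -/
lemma T_apply (x) : T K Φ x = (E1 K Φ).toLinearMap.baseChange ℂ x := rfl

/-- (Ported verbatim from the HodgeCMPerL package; no docstring in the source.) -/
lemma E1_comp_single :
    (E1 K Φ).toLinearMap ∘ₗ (oneEquiv ℚ (cmObj K Φ).L).symm.toLinearMap ∘ₗ
      LinearMap.single ℚ (fun _ : Unit => (FK K : Type)) () = LinearMap.id := by
  refine LinearMap.ext fun y => ?_
  simp [E1]

/-- `T` sends the image of the eigenvector `eT τ` to `eps τ`. -/
lemma T_eT (τ : FK K →+* ℂ) :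
    T K Φ (((oneEquiv ℚ (cmObj K Φ).L).symm.toLinearMap.baseChange ℂ) ((cmObj K Φ).eT () τ)) = eps (FK K) τ := by
  change ((E1 K Φ).toLinearMap.baseChange ℂ ∘ₗ (oneEquiv ℚ (cmObj K Φ).L).symm.toLinearMap.baseChange ℂ ∘ₗ
    (LinearMap.single ℚ (fun _ : Unit => (FK K : Type)) ()).baseChange ℂ) (eps (FK K) τ) = _
  rw [← LinearMap.baseChange_comp, ← LinearMap.baseChange_comp, E1_comp_single, LinearMap.baseChange_id,
    LinearMap.id_apply]

/-- (Ported verbatim from the HodgeCMPerL package; no docstring in the source.) -/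
lemma T_symm_eps (τ : FK K →+* ℂ) :
    (T K Φ).symm (eps (FK K) τ) = ((oneEquiv ℚ (cmObj K Φ).L).symm.toLinearMap.baseChange ℂ) ((cmObj K Φ).eT () τ) := by
  rw [LinearEquiv.symm_apply_eq, T_eT]

/-- (Ported verbatim from the HodgeCMPerL package; no docstring in the source.) -/
lemma E1_comp_map (e : K) :
    (E1 K Φ).toLinearMap ∘ₗ map 1 (mulK K Φ e) = LinearMap.mulLeft ℚ (eK K e) ∘ₗ (E1 K Φ).toLinearMap := by
  have h := oneEquiv_naturality (mulK K Φ e)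
  refine LinearMap.ext fun x => ?_
  have hx := congrArg (fun g => g x) h
  simp only [LinearMap.coe_comp, LinearEquiv.coe_coe, Function.comp_apply] at hx
  simp only [E1, LinearMap.coe_comp, LinearEquiv.coe_coe, Function.comp_apply, LinearEquiv.trans_apply, hx,
    LinearEquiv.funUnique_apply, Function.eval, LinearMap.mulLeft_apply]
  simp [mulK, LinearMap.mulLeft_apply, Pi.mul_apply]

/-- `T` intertwines the CM action with multiplication in `ℂ ⊗ FK K`. -/
lemma T_map_mulK (e : K) (x : ℂ ⊗[ℚ] ↥(⋀[ℚ]^1 (cmObj K Φ).L)) :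
    T K Φ ((map 1 (mulK K Φ e)).baseChange ℂ x) = (1 ⊗ₜ[ℚ] eK K e) * T K Φ x := by
  rw [← baseChange_mulLeft, T_apply, T_apply, ← LinearMap.comp_apply, ← LinearMap.baseChange_comp, E1_comp_map,
    LinearMap.baseChange_comp, LinearMap.comp_apply]

/-! ### M11: eigenlines -/

/-- (Ported verbatim from the HodgeCMPerL package; no docstring in the source.) -/
@[simp] lemma cmAction_ι (e : K) : (cmAction K Φ D).ι e = map 1 (mulK K Φ e) := cmι_apply K Φ e

/-- (Ported verbatim from the HodgeCMPerL package; no docstring in the source.) -/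
lemma mem_eigenLine_iff (σ : K →+* ℂ) (x : ℂ ⊗[ℚ] ↥(⋀[ℚ]^1 (cmObj K Φ).L)) :
    x ∈ (toyModelWith D).eigenLine K Φ σ ↔ ∀ e : K, (map 1 (mulK K Φ e)).baseChange ℂ x = σ e • x := by
  simp only [Universe.eigenLine, Submodule.mem_iInf, Module.End.mem_eigenspace_iff, cmAction_ι]

/-- the generator of the `σ`-eigenline -/
def gen (σ : K →+* ℂ) : ℂ ⊗[ℚ] ↥(⋀[ℚ]^1 (cmObj K Φ).L) := (T K Φ).symm (eps (FK K) (embOf K σ))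

/-- (Ported verbatim from the HodgeCMPerL package; no docstring in the source.) -/
lemma gen_ne_zero (σ : K →+* ℂ) : gen K Φ σ ≠ 0 := by
  simp only [gen, ne_eq, LinearEquiv.map_eq_zero_iff]
  exact eps_ne_zero _

/-- (Ported verbatim from the HodgeCMPerL package; no docstring in the source.) -/
lemma gen_mem_eigenLine (σ : K →+* ℂ) : gen K Φ σ ∈ (toyModelWith D).eigenLine K Φ σ := by
  rw [mem_eigenLine_iff]
  intro e
  apply (T K Φ).injective
  rw [T_map_mulK, map_smul, gen, LinearEquiv.apply_symm_apply, tmul_mul_eps, embOf_apply_eK]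

/-- **The `σ`-eigenline is the line spanned by `gen σ`.** -/
theorem eigenLine_eq (σ : K →+* ℂ) : (toyModelWith D).eigenLine K Φ σ = ℂ ∙ gen K Φ σ := by
  apply le_antisymm
  · intro x hx
    rw [mem_eigenLine_iff] at hx
    have hy : ∀ k : FK K, (1 ⊗ₜ[ℚ] k) * T K Φ x = (embOf K σ) k • T K Φ x := by
      intro k
      have := congrArg (T K Φ) (hx ((eK K).symm k))
      rw [T_map_mulK, map_smul, AlgEquiv.apply_symm_apply] at this
      rw [this]
      rfl
    obtain ⟨c, hc⟩ := Submodule.mem_span_singleton.mp (mem_span_eps_of_eigen (embOf K σ) hy)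
    rw [Submodule.mem_span_singleton]
    refine ⟨c, ?_⟩
    apply (T K Φ).injective
    rw [map_smul, gen, LinearEquiv.apply_symm_apply, hc]
  · rw [Submodule.span_singleton_le_iff_mem]
    exact gen_mem_eigenLine D K Φ σ

/-- (Ported verbatim from the HodgeCMPerL package; no docstring in the source.) -/
theorem fact_eigenLine : (toyModelWith D).Fact_eigenLine := by
  intro K Φ σ
  rw [eigenLine_eq]
  exact finrank_span_singleton (gen_ne_zero K Φ σ)

/-! ### M12: the CM-type condition -/

/-- the holomorphic subspace of `ℂ ⊗ ⋀¹ L` -/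
def F1C : Submodule ℂ (ℂ ⊗[ℚ] ↥(⋀[ℚ]^1 (cmObj K Φ).L)) :=
  (cmObj K Φ).F1.map ((oneEquiv ℚ (cmObj K Φ).L).symm.toLinearMap.baseChange ℂ)

/-- (Ported verbatim from the HodgeCMPerL package; no docstring in the source.) -/
lemma hsF_one : (D.hs (cmObj K Φ) 1).F 1 = F1C K Φ := by
  rw [D.deg1]; simp [Obj.F1filt, F1C]

/-- (Ported verbatim from the HodgeCMPerL package; no docstring in the source.) -/
lemma hsF_zero : (D.hs (cmObj K Φ) 1).F 0 = ⊤ := by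
  rw [D.deg1]; simp [Obj.F1filt]

/-- (Ported verbatim from the HodgeCMPerL package; no docstring in the source.) -/
lemma alphaLine_eq (σ : K →+* ℂ) :
    (toyModelWith D).alphaLine K Φ σ = F1C K Φ ⊓ (toyModelWith D).eigenLine K Φ σ := by
  change (cmAction K Φ D).eigenPiece σ 1 0 = _
  rw [EndAction.eigenPiece, piece_of_add_eq _ (by norm_num), hsF_zero, complexConj_top, inf_top_eq, hsF_one]
  rfl

/-- (Ported verbatim from the HodgeCMPerL package; no docstring in the source.) -/
lemma F1_cmObj_eq : (cmObj K Φ).F1 = Submodule.span ℂ ((fun τ => (cmObj K Φ).eT () τ) '' (atomOf K Φ).Φ) := by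
  unfold Obj.F1
  congr 1
  ext x
  constructor
  · rintro ⟨⟨⟩, τ, hτ, rfl⟩; exact ⟨τ, hτ, rfl⟩
  · rintro ⟨τ, hτ, rfl⟩; exact ⟨(), τ, hτ, rfl⟩

/-- `T (F1C) = span {eps τ : τ ∈ Φ}` -/
lemma F1C_map_T : (F1C K Φ).map (T K Φ).toLinearMap = Submodule.span ℂ (eps (FK K) '' (atomOf K Φ).Φ) := by
  rw [F1C, F1_cmObj_eq, Submodule.map_span, Submodule.map_span, Set.image_image, Set.image_image]
  congr 1
  refine Set.image_congr' fun τ => ?_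
  exact T_eT K Φ τ

/-- (Ported verbatim from the HodgeCMPerL package; no docstring in the source.) -/
lemma mem_atomΦ_iff (τ : FK K →+* ℂ) : τ ∈ (atomOf K Φ).Φ ↔ τ.comp (eK K : K →+* FK K) ∈ Φ.1 := Iff.rfl

/-- (Ported verbatim from the HodgeCMPerL package; no docstring in the source.) -/
lemma embOf_mem_iff (σ : K →+* ℂ) : embOf K σ ∈ (atomOf K Φ).Φ ↔ σ ∈ Φ.1 := by
  rw [mem_atomΦ_iff, embOf_comp]

/-- (Ported verbatim from the HodgeCMPerL package; no docstring in the source.) -/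
lemma gen_mem_F1C {σ : K →+* ℂ} (hσ : σ ∈ Φ.1) : gen K Φ σ ∈ F1C K Φ := by
  rw [gen, T_symm_eps]
  exact Submodule.mem_map_of_mem (Submodule.subset_span ⟨(), embOf K σ, (embOf_mem_iff K Φ σ).mpr hσ, rfl⟩)

/-- (Ported verbatim from the HodgeCMPerL package; no docstring in the source.) -/
theorem fact_alphaLine : (toyModelWith D).Fact_alphaLine := by
  intro K Φ σ
  refine ⟨fun hσ => ?_, fun hσ => ?_⟩
  · rw [alphaLine_eq, inf_eq_right, eigenLine_eq, Submodule.span_singleton_le_iff_mem]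
    exact gen_mem_F1C K Φ hσ
  · rw [alphaLine_eq, eigenLine_eq, eq_bot_iff]
    rintro x ⟨hx1, hx2⟩
    have h1 : T K Φ x ∈ Submodule.span ℂ (eps (FK K) '' (atomOf K Φ).Φ) := by
      rw [← F1C_map_T]; exact Submodule.mem_map_of_mem hx1
    have h2 : T K Φ x ∈ Submodule.span ℂ (eps (FK K) '' {embOf K σ}) := by
      obtain ⟨c, rfl⟩ := Submodule.mem_span_singleton.mp hx2
      rw [Set.image_singleton, map_smul, gen, LinearEquiv.apply_symm_apply]
      exact Submodule.smul_mem _ _ (Submodule.subset_span rfl)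
    have hdis : Disjoint (atomOf K Φ).Φ {embOf K σ} := by
      rw [Set.disjoint_singleton_right, embOf_mem_iff]; exact hσ
    have := (linearIndependent_eps (F := FK K)).disjoint_span_image hdis
    rw [Submodule.disjoint_def] at this
    have hx : T K Φ x = 0 := this _ h1 h2
    rw [Submodule.mem_bot]
    simpa using hx

end

end HodgeCM.Toy
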